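import Literature.AlgebraicGeometry.Modules.SerreTwistModCharts
import Literature.AlgebraicGeometry.Modules.SheafHomFunctor
import HarnessLib

/-!
# The monomial sections `μ_w ∈ Γ(Z, 𝒪_Z(d))` of the Serre twist `𝒪_Z(d) = twistMod ι 𝒪_Z d`

Layer `Literature/AlgebraicGeometry/Modules`, namespace `Literature.AlgebraicGeometry.Modules.SerreTwist`.  ONE DEFINITION with body
(`monomialSection`) + its chart formula; no instance, no notation, no named fact, no `sorry`.  Cell `hodgecm-mathlib` (D-0151), F-5 (5d-I)
brick (γ0) (B-p19 (g16); B-plan1 (g17) token ask 09:25:43Z): the CANONICAL global sections of the positive twist that every F-5 file reads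
(β `Motives/FlatFamilyGrassmannianPoint` at `q := monomialSection`, (II′)/(III-Gr) for `V(u_K)`, L-a on the fibre, γ's base change).

For `ι : Z ⟶ 𝐏ʳ_A` (★ `ProjCech.PP`), `d : ℕ` and a word `w : Fin d → Fin (r + 1)` (the monomial `μ_w = x_{w 0} ⋯ x_{w (d-1)}` of degree `d`;
repetitions allowed, as in ★ `Modules/SerreTwist`), the section `μ_w|_Z ∈ Γ(Z, 𝒪_Z(d))` of the Čech-gluing model ★ `twistMod ι (unitModule Z) d`
(★ `Modules/SerreTwistMod`: families `(n_j ∈ Γ(U ∩ Z_j, 𝒪))` with `n_j = (x_{j'}/x_j)^d n_{j'}`) is the chart family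
`j ↦ μ_w / x_j^d = wordFun ι j w ∈ Γ(Z_j, 𝒪_Z)` (★ `SerreTwist.wordFun`), which satisfies the transition rule by ★ `wordFun_cocycle`
(Hartshorne II Prop. 5.12: `𝒪(d)` has transition functions `(x_{j'}/x_j)^d`; II Prop. 5.13: `Γ_*`).

* `SerreTwist.monomialSection ι d w : Γ(twistMod ι (unitModule Z) d, ⊤)` (DEF, via ★ `mkFamily`);
* `comp_monomialSection` — its `j`-th chart piece is `μ_w / x_j^d` restricted to `⊤ ∩ Z_j` (the formula consumers match against).

Count-neutral Mathlib-side capital; HC_CM is proved only modulo the 7 printed citations until rung 0 closes, nothing here is about HC.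

## References
* [Hartshorne1977] R. Hartshorne, *Algebraic Geometry* (1977), II Prop. 5.12 and Def. p. 117 (`𝒪_X(n)`), II Prop. 5.13 (`Γ_*`).
-/

noncomputable section

-- `TopCat.Presheaf`/`Scheme.Modules` are not reducible (as in Mathlib's `AlgebraicGeometry/Modules/Sheaf.lean`).
set_option backward.isDefEq.respectTransparency false

open CategoryTheory AlgebraicGeometry TopologicalSpace Opposite
open Literature.AlgebraicGeometry.Morphisms Literature.AlgebraicGeometry.Morphisms.ProjCech

universe u

namespace Literature.AlgebraicGeometry.Modules

namespace SerreTwist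

variable {A : Type u} [CommRing A] {r : ℕ} {Z : Scheme.{u}} (ι : Z ⟶ PP A r)

/-- The chart family of the monomial `μ_w` over an open `U`: `j ↦ (μ_w / x_j^d)|_{U ∩ Z_j}`, as sections of `𝒪_Z = unitModule Z`.
[cite: Hartshorne1977, II Prop. 5.12] -/
def monomialFamily (d : ℕ) (w : Fin d → Fin (r + 1)) (U : Z.Opens) : ChartFamily ι (unitModule Z) U :=
  fun j => (show Γ(unitModule Z, U ⊓ Zop ι {j}) from
    Z.presheaf.map (homOfLE (inf_le_right : U ⊓ Zop ι {j} ≤ Zop ι {j})).op (wordFun ι j w))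

/-- The `j`-th member of the monomial chart family, as a function on `U ∩ Z_j`. [cite: Hartshorne1977, II Prop. 5.12] -/
theorem monomialFamily_apply (d : ℕ) (w : Fin d → Fin (r + 1)) (U : Z.Opens) (j : Fin (r + 1)) :
    (show Γ(Z, U ⊓ Zop ι {j}) from monomialFamily ι d w U j) =
      Z.presheaf.map (homOfLE (inf_le_right : U ⊓ Zop ι {j} ≤ Zop ι {j})).op (wordFun ι j w) := rfl

/-- **The monomial chart family satisfies the transition rule of `𝒪(d)`**: `μ_w/x_j^d = (x_{j'}/x_j)^d · μ_w/x_{j'}^d` on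
`U ∩ Z_j ∩ Z_{j'}` (★ `wordFun_cocycle`). [cite: Hartshorne1977, II Prop. 5.12] -/
theorem isTwistFamily_monomialFamily (d : ℕ) (w : Fin d → Fin (r + 1)) (U : Z.Opens) :
    IsTwistFamily ι (unitModule Z) d U (monomialFamily ι d w U) := by
  intro j j' V hV hj hj'
  change Z.presheaf.map (homOfLE (le_inf hV hj)).op
      (Z.presheaf.map (homOfLE (inf_le_right : U ⊓ Zop ι {j} ≤ Zop ι {j})).op (wordFun ι j w)) =
    Z.presheaf.map (homOfLE hj).op (chartFun ι j' j) ^ d *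
      Z.presheaf.map (homOfLE (le_inf hV hj')).op
        (Z.presheaf.map (homOfLE (inf_le_right : U ⊓ Zop ι {j'} ≤ Zop ι {j'})).op (wordFun ι j' w))
  have e1 : Z.presheaf.map (homOfLE (le_inf hV hj)).op
      (Z.presheaf.map (homOfLE (inf_le_right : U ⊓ Zop ι {j} ≤ Zop ι {j})).op (wordFun ι j w)) =
      Z.presheaf.map (homOfLE hj).op (wordFun ι j w) := by
    rw [← CategoryTheory.comp_apply, ← Functor.map_comp]; rfl
  have e2 : Z.presheaf.map (homOfLE (le_inf hV hj')).op
      (Z.presheaf.map (homOfLE (inf_le_right : U ⊓ Zop ι {j'} ≤ Zop ι {j'})).op (wordFun ι j' w)) =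
      Z.presheaf.map (homOfLE hj').op (wordFun ι j' w) := by
    rw [← CategoryTheory.comp_apply, ← Functor.map_comp]; rfl
  rw [e1, e2, wordFun_cocycle ι w j j' hj hj', mul_comm]

/-- **The monomial section `μ_w|_Z ∈ Γ(Z, 𝒪_Z(d))`** of the Serre twist `twistMod ι 𝒪_Z d`: the global section whose chart pieces are
`μ_w / x_j^d` (★ `mkFamily`). [cite: Hartshorne1977, II Prop. 5.12 and Def. p. 117] -/
def monomialSection (d : ℕ) (w : Fin d → Fin (r + 1)) : Γ(twistMod ι (unitModule Z) d, ⊤) :=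
  mkFamily ι (unitModule Z) (monomialFamily ι d w ⊤) (isTwistFamily_monomialFamily ι d w ⊤)

/-- The chart pieces of the monomial section are the monomial chart family. [cite: Hartshorne1977, II Prop. 5.12] -/
@[simp]
theorem comp_monomialSection (d : ℕ) (w : Fin d → Fin (r + 1)) (j : Fin (r + 1)) :
    comp ι (unitModule Z) (monomialSection ι d w) j = monomialFamily ι d w ⊤ j := rfl

/-- **Chart formula**: the `j`-th piece of `μ_w|_Z` is `(μ_w / x_j^d)|_{⊤ ∩ Z_j}`. [cite: Hartshorne1977, II Prop. 5.12] -/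
theorem comp_monomialSection_eq_map_wordFun (d : ℕ) (w : Fin d → Fin (r + 1)) (j : Fin (r + 1)) :
    (show Γ(Z, ⊤ ⊓ Zop ι {j}) from comp ι (unitModule Z) (monomialSection ι d w) j) =
      Z.presheaf.map (homOfLE (inf_le_right : ⊤ ⊓ Zop ι {j} ≤ Zop ι {j})).op (wordFun ι j w) := rfl

/-- The restriction of the monomial section to an open `U` has chart family `monomialFamily ι d w U`.
[cite: Hartshorne1977, II Prop. 5.12] -/
theorem map_monomialSection (d : ℕ) (w : Fin d → Fin (r + 1)) (U : Z.Opens) :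
    (twistMod ι (unitModule Z) d).presheaf.map (homOfLE (le_top : U ≤ ⊤)).op (monomialSection ι d w) =
      mkFamily ι (unitModule Z) (monomialFamily ι d w U) (isTwistFamily_monomialFamily ι d w U) := by
  apply twistMod_ext
  intro j
  rw [comp_map, comp_mkFamily, comp_monomialSection]
  change Z.presheaf.map _ (Z.presheaf.map _ (wordFun ι j w)) = Z.presheaf.map _ (wordFun ι j w)
  rw [← CategoryTheory.comp_apply, ← Functor.map_comp]
  rfl

/-- The degree-`0` monomial section (empty word) is the unit section `1 ∈ Γ(Z, 𝒪_Z(0))` chart by chart (`μ_∅ / x_j^0 = 1`).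
[cite: Hartshorne1977, II Prop. 5.12] -/
theorem comp_monomialSection_zero (w : Fin 0 → Fin (r + 1)) (j : Fin (r + 1)) :
    (show Γ(Z, ⊤ ⊓ Zop ι {j}) from comp ι (unitModule Z) (monomialSection ι 0 w) j) = 1 := by
  rw [comp_monomialSection_eq_map_wordFun, wordFun_zero, map_one]

end SerreTwist

end Literature.AlgebraicGeometry.Modules

end
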